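import Literature.Barriers.BirchSwinnertonDyer.RankNotSumOfLocalInvariantsCNTwists
import Literature.Barriers.BirchSwinnertonDyer.RankNotSumOfLocalInvariantsCNRanksA
import Literature.Barriers.BirchSwinnertonDyer.RankNotSumOfLocalInvariantsCNRanksB
import Literature.Barriers.BirchSwinnertonDyer.RankNotSumOfLocalInvariantsCNRanksC
import Literature.Barriers.BirchSwinnertonDyer.RankNotSumOfLocalInvariantsNarrowProofs
import HarnessLib

/-!
# Rank mod `4` over the fixed field `ℚ` is not a sum of local invariants — UNCONDITIONALLY

This file PROVES conjunct (2) of the NARROWED barrier record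
`Literature.Barriers.BirchSwinnertonDyer.DokchitserDokchitser2011_rankMod_notSumOfLocalInvariantsNarrow`
(`Literature/Barriers/BirchSwinnertonDyer/RankNotSumOfLocalInvariants.lean`):

* `not_isSumOfLocalInvariantsOver_rat_rankMod_four` — there is NO local invariant `λ` with
  `rk E(ℚ) ≡ Σ_{v place of ℚ} λ(E/ℚ_v) (mod 4)` for every elliptic curve `E/ℚ`
  (`¬ IsSumOfLocalInvariantsOver ℚ (fun W ↦ (W.mordellWeilRank : ZMod 4))`), with no hypothesis;

and draws the consequences: the `ℤ`-valued rank over `ℚ` is not a sum of local invariants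
(`rank_notSumOfLocalInvariantsOver_rat_int`, T.–V. Dokchitser 2011 Thm. 1 read over the fixed
field `ℚ`), the case `n = 4` of Theorem 2 of loc. cit. K-uniformly
(`not_isSumOfLocalInvariants_rankMod_four`: "the Mordell–Weil rank modulo `4` is not a sum of
local invariants" — UNCONDITIONAL, the first case of the named entry
`DokchitserDokchitser2011_rankMod_notSumOfLocalInvariants` to be proved in the tree), and the
equivalence of the NARROWED record with the entry (`…Narrow_iff_entry`): what remains named in
the record is exactly `n = 3` and `n = 5` of Theorem 2.

The proof is the printed one — Lemma 5 of loc. cit. over `K = ℚ` ("`Λ(E/K) + Σ_D Λ(E_D/K) = 0`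
… each local term occurs a multiple of `2^k` times"; abstract form
`not_isSumOfLocalInvariantsOver_of_blocks` of the barrier file) — run on a family where every rank
is COMPUTABLE IN LEAN by complete `2`-descent over `ℚ`: the base curve `E₁ : y² = x³ - x` and
`F = ℚ(√-6, √-15, √-159)` (in which every place of `ℚ` splits into `4` or `8` places;
`RankNotSumOfLocalInvariantsCNTwists.lean`), whose eight twists are the congruent number curves
`E_1, E_6, E_10, E_15, E_106, E_159, E_265, E_1590` of ranks `0, 1, 0, 1, 0, 1, 2, 1`
(`RankNotSumOfLocalInvariantsCNRanksA/B/C.lean`, complete `2`-descents with the local conditions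
of `TwoDescentLocalOdd/I0/TwoCN.lean` and explicit points), of sum `6 ≢ 0 (mod 4)`. In print the
instance is `E = 480a1`, `F = ℚ(√-1, √41, √73)`, `rk E(F) = 6` by Magma
(`RankNotSumOfLocalInvariantsNarrowProofs.lean` derives conjunct (2) from that named descent leaf);
the present instance needs no `2`-descent over a number field and no non-`2`-part of `Ш`.

## References

* T. Dokchitser, V. Dokchitser, *A note on the Mordell–Weil rank modulo `n`*, J. Number Theory
  131 (2011) 1833–1839, arXiv:0910.4588: Thms. 1–2, Lemma 5 with proof (p. 3 of the held arXiv
  copy). [DokchitserDokchitser2011RankModN]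
* J. H. Silverman, *The Arithmetic of Elliptic Curves*, 2nd ed., GTM 106 (2009): Prop. X.1.4,
  X.5 Prop. 5.4, III.3.1(b). [SilvermanAEC2009]
-/

noncomputable section


namespace Literature.Barriers.BirchSwinnertonDyer

namespace CongruentDescent

open WeierstrassCurve Literature.NumberTheory.EllipticCurves

/-! ### Transport of local squares to the completions of `ℚ` -/

section Completions

open IsDedekindDomain NumberField

/-- Squares are transported along ring homomorphisms of fields. [folklore] -/
theorem cn_ker_isSquare_map {K K' : Type*} [Field K] [Field K'] (f : K →+* K') {c : CNIdx}
    (h : ∀ D, cnChi c D = 0 → IsSquare ((cnParam D : ℤ) : K)) (D : CNIdx)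
    (hD : cnChi c D = 0) : IsSquare ((cnParam D : ℤ) : K') := by
  obtain ⟨s, hs⟩ := h D hD
  exact ⟨f s, by rw [← map_mul, ← hs, map_intCast]⟩

/-- **Finite places**: over `ℚ_v = v.adicCompletion ℚ` the kernel of some character of the index
group consists of `D` with `d(D) ∈ ℚ_v^{×2}` (`cn_padic_ker_isSquare` at the prime under `v`,
along Mathlib's `ℚ_[p] ≃ ℚ_v`). [folklore] -/
theorem cn_adicCompletion_ker_isSquare (v : HeightOneSpectrum (𝓞 ℚ)) :
    ∃ c : CNIdx, ∀ D, cnChi c D = 0 → IsSquare ((cnParam D : ℤ) : v.adicCompletion ℚ) := by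
  haveI : Fact ((Rat.HeightOneSpectrum.primesEquiv (R := 𝓞 ℚ) v : ℕ)).Prime :=
    ⟨(Rat.HeightOneSpectrum.primesEquiv (R := 𝓞 ℚ) v).2⟩
  let f : ℚ_[(Rat.HeightOneSpectrum.primesEquiv (R := 𝓞 ℚ) v : ℕ)] →+* v.adicCompletion ℚ :=
    (Rat.HeightOneSpectrum.adicCompletion.padicEquiv (R := 𝓞 ℚ) v).symm.toAlgEquiv.toRingEquiv.toRingHom
  obtain ⟨c, hc⟩ := cn_padic_ker_isSquare (Rat.HeightOneSpectrum.primesEquiv (R := 𝓞 ℚ) v : ℕ)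
  exact ⟨c, cn_ker_isSquare_map f hc⟩

/-- **The infinite place**: over `w.Completion ≅ ℝ` the positive classes are squares. [folklore] -/
theorem cn_infinitePlace_ker_isSquare (w : InfinitePlace ℚ) :
    ∃ c : CNIdx, ∀ D, cnChi c D = 0 → IsSquare ((cnParam D : ℤ) : w.Completion) := by
  let f : ℝ →+* w.Completion :=
    (InfinitePlace.Completion.ringEquivRealOfIsReal (IsTotallyReal.isReal w)).symm.toRingHom
  obtain ⟨c, hc⟩ := cn_real_ker_isSquare
  exact ⟨c, cn_ker_isSquare_map f hc⟩

end Completions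

/-- **Lemma 5 of Dokchitser–Dokchitser (2011) for `K = ℚ`, `F = ℚ(√-6, √-15, √-159)`,
`E = E₁ : y² = x³ - x` — PROVED.** A `ℤ/nℤ`-valued (`n ∣ 4`) sum of local invariants `Λ` over
the places of `ℚ` satisfies `Σ_D Λ(E^{(d(D))}) = 0` over the eight twists `cnTwist`; stated
contrapositively. At every finite place (`cn_adicCompletion_ker_isSquare`) and at the infinite
place (`cn_infinitePlace_ker_isSquare`) the twists fall into `4`-blocks of isomorphic curves
(`cn_exists_blocks`), and the barrier file's `not_isSumOfLocalInvariantsOver_of_blocks` counts.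
[cite: DokchitserDokchitser2011RankModN, Lemma 5] -/
theorem not_isSumOfLocalInvariantsOver_rat_of_sum_cnTwist_ne_zero {n : ℕ} (hn : n ∣ 4)
    (Λ : WeierstrassCurve ℚ → ZMod n) (hΛ : ∑ D, Λ (cnTwist D) ≠ 0) :
    ¬ IsSumOfLocalInvariantsOver ℚ Λ :=
  not_isSumOfLocalInvariantsOver_of_blocks ℚ Λ cnTwist
    (fun v ↦ by convert cn_exists_blocks hn (cn_adicCompletion_ker_isSquare v))
    (fun w ↦ by convert cn_exists_blocks hn (cn_infinitePlace_ker_isSquare w)) hΛ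

/-! ### The eight twists are congruent number curves; their ranks -/

/-- **`E₁^{(d)} = E_{|d|}`**: the twist of `y² = x³ - x` by an integer `d` is the congruent
number curve `y² = x³ - d²x` (same Weierstrass model). [folklore] -/
theorem quadraticTwist_cn_one (d : ℤ) :
    (congruentNumberCurve 1).quadraticTwist (d : ℚ) = congruentNumberCurve d.natAbs := by
  have hd : ((d.natAbs : ℕ) : ℚ) ^ 2 = (d : ℚ) ^ 2 := by
    rw [Nat.cast_natAbs, Int.cast_abs, sq_abs]
  ext
  · rfl
  · simp [quadraticTwist, congruentNumberCurve, WeierstrassCurve.b₂]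
  · rfl
  · simp only [quadraticTwist, congruentNumberCurve, WeierstrassCurve.b₄]
    rw [hd]; ring
  · simp [quadraticTwist, congruentNumberCurve, WeierstrassCurve.b₆]

/-- `cnTwist D = E_{|d(D)|}`. [folklore] -/
theorem cnTwist_eq (D : CNIdx) : cnTwist D = congruentNumberCurve (cnParam D).natAbs :=
  quadraticTwist_cn_one _

/-- **The eight ranks**: `rk E_1 = 0, rk E_159 = 1, rk E_15 = 1, rk E_265 = 2, rk E_6 = 1,
rk E_106 = 0, rk E_10 = 0, rk E_1590 = 1`, summed mod `4`: `Σ_D rk E^{(d(D))}(ℚ) ≡ 6 ≡ 2`.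
[cite: SilvermanAEC2009, Prop. X.1.4] -/
theorem sum_mordellWeilRank_cnTwist_mod_four :
    ∑ D, ((cnTwist D).mordellWeilRank : ZMod 4) = 2 := by
  simp only [Fintype.sum_prod_type, Fin.sum_univ_two, cnTwist_eq]
  rw [show (cnParam (0, 0, 0)).natAbs = 1 from rfl, show (cnParam (0, 0, 1)).natAbs = 159 from rfl,
    show (cnParam (0, 1, 0)).natAbs = 15 from rfl, show (cnParam (0, 1, 1)).natAbs = 265 from rfl,
    show (cnParam (1, 0, 0)).natAbs = 6 from rfl, show (cnParam (1, 0, 1)).natAbs = 106 from rfl,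
    show (cnParam (1, 1, 0)).natAbs = 10 from rfl, show (cnParam (1, 1, 1)).natAbs = 1590 from rfl]
  rw [show (congruentNumberCurve 1).mordellWeilRank = 0 from E1.mordellWeilRank_eq,
    show (congruentNumberCurve 159).mordellWeilRank = 1 from E159.mordellWeilRank_eq,
    show (congruentNumberCurve 15).mordellWeilRank = 1 from E15.mordellWeilRank_eq,
    show (congruentNumberCurve 265).mordellWeilRank = 2 from E265.mordellWeilRank_eq,
    show (congruentNumberCurve 6).mordellWeilRank = 1 from E6.mordellWeilRank_eq,
    show (congruentNumberCurve 106).mordellWeilRank = 0 from E106.mordellWeilRank_eq,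
    show (congruentNumberCurve 10).mordellWeilRank = 0 from E10.mordellWeilRank_eq,
    show (congruentNumberCurve 1590).mordellWeilRank = 1 from E1590.mordellWeilRank_eq]
  decide

end CongruentDescent

open CongruentDescent

/-! ### Conjunct (2) of the NARROWED record, unconditionally, and consequences -/

/-- **The Mordell–Weil rank modulo `4` of elliptic curves over `ℚ` is NOT a sum of local
invariants over the places of `ℚ`** — conjunct (2) of
`DokchitserDokchitser2011_rankMod_notSumOfLocalInvariantsNarrow`, PROVED with no hypothesis: by
Lemma 5 of Dokchitser–Dokchitser (2011) for `(ℚ, ℚ(√-6, √-15, √-159), E₁)`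
(`not_isSumOfLocalInvariantsOver_rat_of_sum_cnTwist_ne_zero`) a formula would force
`Σ_D rk E₁^{(d(D))}(ℚ) ≡ 0 (mod 4)`, but the sum is `0+1+1+2+1+0+0+1 = 6`
(`sum_mordellWeilRank_cnTwist_mod_four`). [cite: DokchitserDokchitser2011RankModN, Lemma 5 and proof of Thm. 2] -/
theorem not_isSumOfLocalInvariantsOver_rat_rankMod_four :
    ¬ IsSumOfLocalInvariantsOver ℚ (fun W ↦ (W.mordellWeilRank : ZMod 4)) :=
  not_isSumOfLocalInvariantsOver_rat_of_sum_cnTwist_ne_zero (dvd_refl 4) _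
    (by rw [sum_mordellWeilRank_cnTwist_mod_four]; decide)

/-- **Theorem 2 of Dokchitser–Dokchitser (2011), case `n = 4`, UNCONDITIONALLY**: the
Mordell–Weil rank modulo `4` is not a sum of local invariants (one `λ` for all number fields) — a
`λ` serving all number fields serves `ℚ` (`IsSumOfLocalInvariants.over`).
[cite: DokchitserDokchitser2011RankModN, Thm. 2] -/
theorem not_isSumOfLocalInvariants_rankMod_four :
    ¬ IsSumOfLocalInvariants (rankInvariant (ZMod 4)) :=
  fun h ↦ not_isSumOfLocalInvariantsOver_rat_rankMod_four (h.over ℚ)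

/-- **Theorem 1 over the fixed field `ℚ`, UNCONDITIONALLY**: the Mordell–Weil rank of elliptic
curves over `ℚ` is not a `ℤ`-valued sum of local invariants over the places of `ℚ` — a `ℤ`-valued
formula would reduce modulo `4` (`LocalInvariant.map (Int.castAddHom (ZMod 4))`,
`LocalInvariant.localSum_map`) to the formula excluded by
`not_isSumOfLocalInvariantsOver_rat_rankMod_four`; the printed reduction of Thm. 1 to Thm. 2, run
over `ℚ` with `n = 4`. [cite: DokchitserDokchitser2011RankModN, §1 (Thm. 1 from Thm. 2) and Lemma 5] -/
theorem rank_notSumOfLocalInvariantsOver_rat_int :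
    ¬ IsSumOfLocalInvariantsOver ℚ (fun W ↦ (W.mordellWeilRank : ℤ)) := by
  rintro ⟨lam, hfin, hsum⟩
  refine not_isSumOfLocalInvariantsOver_rat_rankMod_four ⟨lam.map (Int.castAddHom (ZMod 4)), ?_, ?_⟩
  · intro W _
    exact (hfin W).subset (Function.support_comp_subset (map_zero _) _)
  · intro W _
    rw [LocalInvariant.localSum_map _ _ ℚ W (hfin W), ← hsum W]
    simp

/-- **The Mordell–Weil rank is not a sum of local invariants (T.–V. Dokchitser 2011, Thm. 1),
UNCONDITIONALLY**: a `ℤ`-valued `λ` serving all number fields serves `ℚ`. (The tree's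
`rank_notSumOfLocalInvariants` derives Thm. 1 from the named Thm. 2; here it is absolute.)
[cite: DokchitserDokchitser2011RankModN, Thm. 1] -/
theorem rank_notSumOfLocalInvariants_unconditional :
    ¬ IsSumOfLocalInvariants (rankInvariant ℤ) :=
  fun h ↦ rank_notSumOfLocalInvariantsOver_rat_int (h.over ℚ)

/-- **The NARROWED record is equivalent to the entry**: its conjunct (2) being proved
(`not_isSumOfLocalInvariantsOver_rat_rankMod_four`), what remains of
`DokchitserDokchitser2011_rankMod_notSumOfLocalInvariantsNarrow` is exactly Theorem 2 of
Dokchitser–Dokchitser (2011) for `n ∈ {3, 4, 5}` (`DokchitserDokchitser2011_rankMod_notSumOfLocalInvariants`),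
of which `n = 4` is now proved (`not_isSumOfLocalInvariants_rankMod_four`) and `n = 3, 5` rest on
the `2`-descents over the cubic / quintic fields `F₃, F₅` of the printed proof.
[cite: DokchitserDokchitser2011RankModN, Thm. 2 and Lemma 5] -/
theorem DokchitserDokchitser2011_rankMod_notSumOfLocalInvariantsNarrow_iff_entry :
    DokchitserDokchitser2011_rankMod_notSumOfLocalInvariantsNarrow ↔
      DokchitserDokchitser2011_rankMod_notSumOfLocalInvariants :=
  ⟨fun h ↦ h.1, fun h ↦ ⟨h, not_isSumOfLocalInvariantsOver_rat_rankMod_four⟩⟩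

/-- The NARROWED record from the entry alone. [cite: DokchitserDokchitser2011RankModN, Thm. 2] -/
theorem DokchitserDokchitser2011_rankMod_notSumOfLocalInvariantsNarrow_of_entry
    (h : DokchitserDokchitser2011_rankMod_notSumOfLocalInvariants) :
    DokchitserDokchitser2011_rankMod_notSumOfLocalInvariantsNarrow :=
  ⟨h, not_isSumOfLocalInvariantsOver_rat_rankMod_four⟩

/-- **The NARROWED record from the `n = 3` and `n = 5` cases of Theorem 2 alone** (the `n = 4`
case and conjunct (2) being proved here). [cite: DokchitserDokchitser2011RankModN, Thm. 2] -/
theorem DokchitserDokchitser2011_rankMod_notSumOfLocalInvariantsNarrow_of_three_five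
    (h₃ : ¬ IsSumOfLocalInvariants (rankInvariant (ZMod 3)))
    (h₅ : ¬ IsSumOfLocalInvariants (rankInvariant (ZMod 5))) :
    DokchitserDokchitser2011_rankMod_notSumOfLocalInvariantsNarrow := by
  refine ⟨fun n hn ↦ ?_, not_isSumOfLocalInvariantsOver_rat_rankMod_four⟩
  simp only [Finset.mem_insert, Finset.mem_singleton] at hn
  rcases hn with rfl | rfl | rfl
  · exact h₃
  · exact not_isSumOfLocalInvariants_rankMod_four
  · exact h₅

end Literature.Barriers.BirchSwinnertonDyer

end
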